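import Mathlib
import Summits.ValiantsHypothesis.ValiantsHypothesis.Theorems.KPlusLogSqLawWeakLiftingTowerGraftSkewBlockCrossings

/-!
# Tower graft line — A KERNEL INSTANCE of the skew-block phantoms: `(m, K) = (4, 3)` on the 4-tower `(1, 5, 21)`, eight phantoms, rootless digits

Calibration datum for the line `Cruxes/WeakLifting/Lines/tower_graft.lean` (crux `WeakLifting` = stmt-ValiantsHypothesis-19561; S4b; crit-6
kill-shape #38⁺).  NO stub is claimed.  Shows that the hypotheses of `skewBlock_phantoms_square` (`…SkewBlockCrossings`) are met by explicit
RATIONAL data: `B(t)` upper bidiagonal `2 × 2` with diagonal trinomials `t·(α + β t⁴ + t²⁰)` vanishing exactly at `t ∈ {1,2}` resp. `{3,4}`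
(`α₁ = 69904`, `β₁ = −69905`; `α₂ = 503816143104`, `β₂ = −6262999105`) and superdiagonal `t`; `det B(t) = b₁₁(t)·b₂₂(t)` vanishes at
`1, 2, 3, 4` and not at the half-integers `1/2, …, 9/2`; deleting column `0` leaves `(t, b₂₂(t))ᵀ`, of full rank for `t > 0`.  Hence
(`skewBlock_phantoms_four_three`): on the genuine 4-tower `d = (1, 5, 21)` with the corner at the tower-top exponent `D = 85`, for some `η > 0`
the `4 × 4` symmetric three-letter skew-block pencil has a corner graft with **at least 8 distinct positive roots while BOTH digits `det G`,
`det G₃₃` have none** — a kernel datum for «no instance-level corner law below the class maximum» (the floor-currency bound would be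
`c·(0 + 0 + 4·3 + 1)`; the class budget `B ≥ ζ₊(4;(1,5,21)) ≥ 4·2 = 8` by the Descartes-floor lemma pays, nothing against S4b).
HONEST FRAMING: one explicit instance (fixed size, zero crux credit); VP ≠ VNP NOT proved.  Def-free.
Seat: prover val-sym-lift-p2 g19, `--supports stmt-ValiantsHypothesis-19561`.
-/

-- `Summit.ValiantsHypothesis.ValiantsHypothesis.…` repeats a component by the D-0017 layout
-- (single-conjunct summit), which the `dupNamespace` linter flags; the name is mandated.
set_option linter.dupNamespace false

namespace Summit.ValiantsHypothesis.ValiantsHypothesis.Theorems.KPlusLogSqLaw.TowerGraft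

open Polynomial Matrix
open scoped BigOperators Polynomial

section InstanceFourThree

/-- **EIGHT PHANTOMS WITH ROOTLESS DIGITS AT `(m, K) = (4, 3)` (kernel instance of the skew-block family).** [this work] -/
theorem skewBlock_phantoms_four_three :
    ∃ (B : Fin 3 → Matrix (Fin 2) (Fin 2) ℝ) (η : ℝ), 0 < η ∧
      ((∑ l, (X : ℝ[X]) ^ (![1, 5, 21] : Fin 3 → ℕ) l • (Matrix.fromBlocks (if l = 0 then η • (1 : Matrix (Fin 2) (Fin 2) ℝ) else 0) (B l)
        (B l)ᵀ (if l = 0 then -(η • (1 : Matrix (Fin 2) (Fin 2) ℝ)) else 0)).map C).det.roots.toFinset.filter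
        (fun t => 0 < t)).card = 0 ∧
      (((∑ l, (X : ℝ[X]) ^ (![1, 5, 21] : Fin 3 → ℕ) l • (Matrix.fromBlocks (if l = 0 then η • (1 : Matrix (Fin 2) (Fin 2) ℝ) else 0) (B l)
        (B l)ᵀ (if l = 0 then -(η • (1 : Matrix (Fin 2) (Fin 2) ℝ)) else 0)).map C).submatrix
        (Sum.map id (0 : Fin 2).succAbove) (Sum.map id (0 : Fin 2).succAbove)).det.roots.toFinset.filter (fun t => 0 < t)).card = 0 ∧
      8 ≤ ((((∑ l, (X : ℝ[X]) ^ (![1, 5, 21] : Fin 3 → ℕ) l • (Matrix.fromBlocks (if l = 0 then η • (1 : Matrix (Fin 2) (Fin 2) ℝ) else 0)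
          (B l) (B l)ᵀ (if l = 0 then -(η • (1 : Matrix (Fin 2) (Fin 2) ℝ)) else 0)).map C) +
        (X : ℝ[X]) ^ 85 • Matrix.single (Sum.inr 0 : Fin 2 ⊕ Fin 2) (Sum.inr 0) (1 : ℝ[X])).det).roots.toFinset.filter
        (fun t => 0 < t)).card := by
  -- the letters of `B(t) = [[b₁₁(t), t],[0, b₂₂(t)]]`
  set B : Fin 3 → Matrix (Fin 2) (Fin 2) ℝ := ![!![69904, 1; 0, 503816143104], !![-69905, 0; 0, -6262999105], !![1, 0; 0, 1]] with hB
  refine ⟨B, ?_⟩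
  -- the real pencil at `t`
  have hBt : ∀ t : ℝ, (∑ l, t ^ (![1, 5, 21] : Fin 3 → ℕ) l • B l) =
      !![69904 * t - 69905 * t ^ 5 + t ^ 21, t; 0, 503816143104 * t - 6262999105 * t ^ 5 + t ^ 21] := by
    intro t
    ext i j
    rw [Matrix.sum_apply, Fin.sum_univ_three]
    fin_cases i <;> fin_cases j <;> simp [hB] <;> ring
  have hdet : ∀ t : ℝ, (∑ l, t ^ (![1, 5, 21] : Fin 3 → ℕ) l • B l).det =
      (69904 * t - 69905 * t ^ 5 + t ^ 21) * (503816143104 * t - 6262999105 * t ^ 5 + t ^ 21) := by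
    intro t; rw [hBt, Matrix.det_fin_two_of]; ring
  have hminor : ∀ t : ℝ, (((∑ l, t ^ (![1, 5, 21] : Fin 3 → ℕ) l • B l).submatrix id (0 : Fin 2).succAbove)ᵀ *
      ((∑ l, t ^ (![1, 5, 21] : Fin 3 → ℕ) l • B l).submatrix id (0 : Fin 2).succAbove)).det =
      t ^ 2 + (503816143104 * t - 6262999105 * t ^ 5 + t ^ 21) ^ 2 := by
    intro t
    rw [hBt, Matrix.det_fin_one]
    simp [Matrix.mul_apply, Fin.sum_univ_two, Matrix.submatrix_apply]
    ring
  obtain ⟨η, hη, h1, h2, h3⟩ := skewBlock_phantoms_square (![1, 5, 21] : Fin 3 → ℕ) 0 85 B 0 4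
    (fun i => (i : ℝ) + 1 / 2) (fun i => (i : ℝ) + 1) (fun i => by simp; norm_num) (fun i => by push_cast; linarith)
    (fun i => by positivity)
    (fun i hi => by
      rw [hdet]
      interval_cases i <;> norm_num)
    (fun i hi => by
      rw [hdet]
      interval_cases i <;> norm_num)
    (fun i hi => by
      rw [hminor]
      have : (0 : ℝ) < ((i : ℝ) + 1) ^ 2 := by positivity
      nlinarith [sq_nonneg (503816143104 * ((i : ℝ) + 1) - 6262999105 * ((i : ℝ) + 1) ^ 5 + ((i : ℝ) + 1) ^ 21)])
  exact ⟨η, hη, h1, h2, h3⟩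

end InstanceFourThree

end Summit.ValiantsHypothesis.ValiantsHypothesis.Theorems.KPlusLogSqLaw.TowerGraft
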